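import Summits.Ventures.LatticeQCDFlow.Exactness.Phi4IndependenceSamplerExact
import Mathlib.MeasureTheory.Integral.Prod
import HarnessLib

/-!
# The flow sampler's one-step operator on observables: boundedness, measurability, invariance, minorisation

HONEST FRAMING: exact (Metropolis-corrected) sampling algorithms for lattice gauge theory;
figures of merit are autocorrelation/cost numbers at stated couplings and volumes; no
continuum-physics claim.  (SCALAR calibration rung S0-A: not a gauge result.)

Venture `LatticeQCDFlow` (cell pub-lqcd), topic `Exactness`; FANOUT row 2 (`s0-phi4`, FLOW arm:
real-NVP proposals + independence-Metropolis accept/reject).  NEW WORK of the cell over Mathlib and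
row 2's `Exactness/Phi4IndependenceSamplerExact.lean` (`imh_integral_invariant`); nothing is cited
as a fact.  This is the toolbox for `Exactness/FlowSamplerSpectralGap.lean` (the `L²` contraction
`∫ (K g)² w ≤ (1 − Z/C)² ∫ g² w` on mean-zero observables from a weight bound `w ≤ C q`).

## What is here (general measure space `(X, μ)`; target weight `w > 0`, proposal density `q > 0`
with `∫ q dμ = 1`)

* `imhAcceptQ w q t t' = min(1, w(t')q(t)/(w(t)q(t')))` and the named operator
  `imhOp μ w q g (t) = ∫ [α g(t') + (1 − α) g(t)] q(t') dμ(t')` (row 2's `imhOpPhi4 J λ q f` is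
  `imhOp volume (gibbsWeight J λ) q f` by `rfl`);
* `imhAcceptQ_mul_ge` — the MINORISATION in density form: `w ≤ C q` gives
  `w(t')/C ≤ α(t,t') q(t')` from every current state;
* `imhOp_abs_le` (`|K g| ≤ B` if `|g| ≤ B`), `measurable_imhOp` (Fubini measurability),
  `imhOp_sub_const` (`K` fixes constants), `integral_imhOp_mul` (`∫ (K g) w = ∫ g w`, row 2's
  invariance renamed);
* `sq_integral_le_integral_mul_integral` — weighted Cauchy–Schwarz `(∫ m g)² ≤ (∫ m)(∫ m g²)` for a
  nonnegative integrable weight and a bounded observable; `sq_add_mul_le` — the quadratic-form step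
  `(u + r x)² ≤ (U + r)(v + r x²)` from `u² ≤ U v`.
-/

namespace Summit.Ventures.LatticeQCDFlow.Exactness

open Real MeasureTheory Filter

variable {X : Type*} [MeasurableSpace X] {μ : Measure X}

/-! ## The operator -/

/-- The independence-sampler acceptance with target weight `w` and proposal density `q`:
`α(t, t') = min(1, w(t') q(t) / (w(t) q(t')))`. -/
noncomputable def imhAcceptQ (w q : X → ℝ) (t t' : X) : ℝ := min 1 (w t' * q t / (w t * q t'))

/-- The sampler's one-step operator on observables: propose `t' ∼ q dμ`, accept with `α`, else
stay.  (`imhOpPhi4 J λ q f = imhOp volume (gibbsWeight J λ) q f` by `rfl`.) -/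
noncomputable def imhOp (μ : Measure X) (w q g : X → ℝ) (t : X) : ℝ :=
  ∫ t', (imhAcceptQ w q t t' * g t' + (1 - imhAcceptQ w q t t') * g t) * q t' ∂μ

section Basic

variable {w q : X → ℝ}

omit [MeasurableSpace X] in
/-- `0 ≤ α ≤ 1`. -/
theorem imhAcceptQ_nonneg (hw0 : ∀ t, 0 < w t) (hq0 : ∀ t, 0 < q t) (t t' : X) :
    0 ≤ imhAcceptQ w q t t' :=
  le_min zero_le_one (div_nonneg (mul_pos (hw0 t') (hq0 t)).le (mul_pos (hw0 t) (hq0 t')).le)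

omit [MeasurableSpace X] in
/-- `α ≤ 1`. -/
theorem imhAcceptQ_le_one (w q : X → ℝ) (t t' : X) : imhAcceptQ w q t t' ≤ 1 := min_le_left _ _

/-- Joint measurability of `α`. -/
theorem measurable_imhAcceptQ (hwm : Measurable w) (hqm : Measurable q) :
    Measurable fun p : X × X => imhAcceptQ w q p.1 p.2 := by
  unfold imhAcceptQ
  exact measurable_const.min (((hwm.comp measurable_snd).mul (hqm.comp measurable_fst)).div
    ((hwm.comp measurable_fst).mul (hqm.comp measurable_snd)))

omit [MeasurableSpace X] in
/-- **Minorisation in density form.**  If `w ≤ C q` then from EVERY current state `t` the accepted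
proposal density dominates `w/C`: `w(t')/C ≤ α(t,t') q(t')`. -/
theorem imhAcceptQ_mul_ge (hw0 : ∀ t, 0 < w t) (hq0 : ∀ t, 0 < q t) {C : ℝ}
    (hC : ∀ t, w t ≤ C * q t) (t t' : X) : w t' / C ≤ imhAcceptQ w q t t' * q t' := by
  have hCpos : 0 < C := by
    have h := hC t
    exact pos_of_mul_pos_left ((hw0 t).trans_le h) (hq0 t).le
  unfold imhAcceptQ
  rcases le_total 1 (w t' * q t / (w t * q t')) with h | h
  · rw [min_eq_left h, one_mul]
    exact (div_le_iff₀ hCpos).2 (by rw [mul_comm]; exact hC t')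
  · rw [min_eq_right h]
    have hq' : q t' ≠ 0 := (hq0 t').ne'
    have hw' : w t ≠ 0 := (hw0 t).ne'
    have e : w t' * q t / (w t * q t') * q t' = w t' * q t / w t := by
      field_simp
    -- `w t'/C ≤ w t' q t / w t` since `q t / w t ≥ 1/C`
    rw [e, div_le_div_iff₀ hCpos (hw0 t)]
    calc w t' * w t ≤ w t' * (C * q t) := mul_le_mul_of_nonneg_left (hC t) (hw0 t').le
      _ = w t' * q t * C := by ring

omit [MeasurableSpace X] in
/-- The integrand of `K g` at `t` is dominated by `B q`. -/
theorem imhOp_integrand_abs_le (hw0 : ∀ t, 0 < w t) (hq0 : ∀ t, 0 < q t) {g : X → ℝ} {B : ℝ}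
    (hgb : ∀ t, |g t| ≤ B) (t t' : X) :
    |(imhAcceptQ w q t t' * g t' + (1 - imhAcceptQ w q t t') * g t) * q t'| ≤ B * q t' := by
  have ha0 := imhAcceptQ_nonneg hw0 hq0 t t'
  have ha1 := imhAcceptQ_le_one w q t t'
  rw [abs_mul, abs_of_pos (hq0 t')]
  refine mul_le_mul_of_nonneg_right ?_ (hq0 t').le
  calc |imhAcceptQ w q t t' * g t' + (1 - imhAcceptQ w q t t') * g t|
      ≤ |imhAcceptQ w q t t' * g t'| + |(1 - imhAcceptQ w q t t') * g t| := abs_add_le _ _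
    _ = imhAcceptQ w q t t' * |g t'| + (1 - imhAcceptQ w q t t') * |g t| := by
        rw [abs_mul, abs_mul, abs_of_nonneg ha0, abs_of_nonneg (sub_nonneg.2 ha1)]
    _ ≤ imhAcceptQ w q t t' * B + (1 - imhAcceptQ w q t t') * B :=
        add_le_add (mul_le_mul_of_nonneg_left (hgb t') ha0)
          (mul_le_mul_of_nonneg_left (hgb t) (sub_nonneg.2 ha1))
    _ = B := by ring

/-- The integrand of `K g` at `t` is integrable in `t'`. -/
theorem integrable_imhOp_integrand (hw0 : ∀ t, 0 < w t) (hwm : Measurable w) (hq0 : ∀ t, 0 < q t)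
    (hqm : Measurable q) (hqi : Integrable q μ) {g : X → ℝ} (hgm : Measurable g) {B : ℝ}
    (hgb : ∀ t, |g t| ≤ B) (t : X) :
    Integrable (fun t' => (imhAcceptQ w q t t' * g t' + (1 - imhAcceptQ w q t t') * g t) * q t') μ := by
  have ham : Measurable fun t' => imhAcceptQ w q t t' :=
    (measurable_imhAcceptQ hwm hqm).comp (measurable_const.prodMk measurable_id)
  refine Integrable.mono' (hqi.const_mul B)
    (((ham.mul hgm).add ((measurable_const.sub ham).mul measurable_const)).mul hqm).aestronglyMeasurable
    (Eventually.of_forall fun t' => ?_)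
  rw [Real.norm_eq_abs]
  exact imhOp_integrand_abs_le hw0 hq0 hgb t t'

/-- **`K` is a contraction in sup norm**: `|K g| ≤ B` if `|g| ≤ B`. -/
theorem imhOp_abs_le (hw0 : ∀ t, 0 < w t) (hq0 : ∀ t, 0 < q t) (hqi : Integrable q μ)
    (hq1 : ∫ t, q t ∂μ = 1) {g : X → ℝ} {B : ℝ} (hgb : ∀ t, |g t| ≤ B) (t : X) :
    |imhOp μ w q g t| ≤ B := by
  unfold imhOp
  calc |∫ t', (imhAcceptQ w q t t' * g t' + (1 - imhAcceptQ w q t t') * g t) * q t' ∂μ|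
      ≤ ∫ t', B * q t' ∂μ := by
        rw [← Real.norm_eq_abs]
        exact norm_integral_le_of_norm_le (hqi.const_mul B)
          (Eventually.of_forall fun t' => by
            rw [Real.norm_eq_abs]; exact imhOp_integrand_abs_le hw0 hq0 hgb t t')
    _ = B := by rw [integral_const_mul, hq1, mul_one]

/-- **`K g` is measurable** (Fubini measurability of a jointly measurable integrand). -/
theorem measurable_imhOp [SFinite μ] (hwm : Measurable w) (hqm : Measurable q) {g : X → ℝ}
    (hgm : Measurable g) : Measurable (imhOp μ w q g) := by
  have hF : Measurable fun p : X × X =>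
      (imhAcceptQ w q p.1 p.2 * g p.2 + (1 - imhAcceptQ w q p.1 p.2) * g p.1) * q p.2 :=
    (((measurable_imhAcceptQ hwm hqm).mul (hgm.comp measurable_snd)).add
      ((measurable_const.sub (measurable_imhAcceptQ hwm hqm)).mul (hgm.comp measurable_fst))).mul
      (hqm.comp measurable_snd)
  exact (hF.stronglyMeasurable.integral_prod_right (ν := μ)).measurable

/-- **`K` fixes constants**: `K (g − c) = K g − c` (`∫ q = 1`). -/
theorem imhOp_sub_const (hw0 : ∀ t, 0 < w t) (hwm : Measurable w) (hq0 : ∀ t, 0 < q t)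
    (hqm : Measurable q) (hqi : Integrable q μ) (hq1 : ∫ t, q t ∂μ = 1) {g : X → ℝ}
    (hgm : Measurable g) {B : ℝ} (hgb : ∀ t, |g t| ≤ B) (c : ℝ) (t : X) :
    imhOp μ w q (fun s => g s - c) t = imhOp μ w q g t - c := by
  unfold imhOp
  have hsplit : ∀ t', (imhAcceptQ w q t t' * (g t' - c) + (1 - imhAcceptQ w q t t') * (g t - c)) * q t'
      = (imhAcceptQ w q t t' * g t' + (1 - imhAcceptQ w q t t') * g t) * q t' - c * q t' := by
    intro t'; ring
  simp_rw [hsplit]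
  rw [integral_sub (integrable_imhOp_integrand hw0 hwm hq0 hqm hqi hgm hgb t) (hqi.const_mul c),
    integral_const_mul, hq1, mul_one]

/-- **Invariance** (row 2's `imh_integral_invariant`, for the named operator):
`∫ (K g) w dμ = ∫ g w dμ`. -/
theorem integral_imhOp_mul [SFinite μ] (hw0 : ∀ t, 0 < w t) (hwm : Measurable w)
    (hwi : Integrable w μ) (hq0 : ∀ t, 0 < q t) (hqm : Measurable q) (hqi : Integrable q μ)
    (hq1 : ∫ t, q t ∂μ = 1) {g : X → ℝ} (hgm : Measurable g) {B : ℝ} (hgb : ∀ t, |g t| ≤ B) :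
    ∫ t, imhOp μ w q g t * w t ∂μ = ∫ t, g t * w t ∂μ :=
  imh_integral_invariant hw0 hwm hwi hq0 hqm hqi hq1 hgm hgb

end Basic

/-! ## Weighted Cauchy–Schwarz and the quadratic-form step -/

section CauchySchwarz

/-- **Weighted Cauchy–Schwarz**: for a nonnegative integrable weight `m` and a bounded measurable
`g`, `(∫ m g)² ≤ (∫ m)(∫ m g²)`. -/
theorem sq_integral_le_integral_mul_integral {m g : X → ℝ} (hm0 : ∀ t, 0 ≤ m t)
    (hmm : Measurable m) (hmi : Integrable m μ) (hgm : Measurable g) {B : ℝ} (hgb : ∀ t, |g t| ≤ B) :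
    (∫ t, m t * g t ∂μ) ^ 2 ≤ (∫ t, m t ∂μ) * ∫ t, m t * g t ^ 2 ∂μ := by
  have hmg : Integrable (fun t => m t * g t) μ := by
    refine Integrable.mono' (hmi.const_mul B) (hmm.mul hgm).aestronglyMeasurable
      (Eventually.of_forall fun t => ?_)
    rw [Real.norm_eq_abs, abs_mul, abs_of_nonneg (hm0 t), mul_comm]
    exact mul_le_mul_of_nonneg_right (hgb t) (hm0 t)
  have hmg2 : Integrable (fun t => m t * g t ^ 2) μ := by
    refine Integrable.mono' (hmi.const_mul (B ^ 2)) (hmm.mul (hgm.pow_const 2)).aestronglyMeasurable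
      (Eventually.of_forall fun t => ?_)
    rw [Real.norm_eq_abs, abs_mul, abs_of_nonneg (hm0 t), mul_comm]
    refine mul_le_mul_of_nonneg_right ?_ (hm0 t)
    rw [abs_of_nonneg (sq_nonneg _), ← sq_abs]
    exact pow_le_pow_left₀ (abs_nonneg _) (hgb t) 2
  set U := ∫ t, m t ∂μ with hU
  set u := ∫ t, m t * g t ∂μ with hu
  set v := ∫ t, m t * g t ^ 2 ∂μ with hv
  have hU0 : 0 ≤ U := integral_nonneg hm0
  have hv0 : 0 ≤ v := integral_nonneg fun t => mul_nonneg (hm0 t) (sq_nonneg _)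
  rcases eq_or_lt_of_le hU0 with hUz | hUpos
  · -- `∫ m = 0`: `m = 0` a.e., so `u = 0`
    have hae : m =ᵐ[μ] 0 :=
      (integral_eq_zero_iff_of_nonneg (fun t => hm0 t) hmi).1 hUz.symm
    have huz : u = 0 := by
      rw [hu]
      refine integral_eq_zero_of_ae ?_
      filter_upwards [hae] with t ht
      simp [ht]
    rw [huz, ← hUz]
    simp
  · -- `∫ m > 0`: expand `0 ≤ ∫ m (g − u/U)²`
    have hint : Integrable (fun t => m t * (g t - u / U) ^ 2) μ := by
      have e : (fun t => m t * (g t - u / U) ^ 2)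
          = fun t => m t * g t ^ 2 - 2 * (u / U) * (m t * g t) + (u / U) ^ 2 * m t := by
        funext t; ring
      rw [e]
      exact (hmg2.sub (hmg.const_mul _)).add (hmi.const_mul _)
    have h0 : 0 ≤ ∫ t, m t * (g t - u / U) ^ 2 ∂μ :=
      integral_nonneg fun t => mul_nonneg (hm0 t) (sq_nonneg _)
    have e : ∫ t, m t * (g t - u / U) ^ 2 ∂μ = v - 2 * (u / U) * u + (u / U) ^ 2 * U := by
      have e1 : ∀ t, m t * (g t - u / U) ^ 2
          = m t * g t ^ 2 - 2 * (u / U) * (m t * g t) + (u / U) ^ 2 * m t := by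
        intro t; ring
      simp_rw [e1]
      have i12 : Integrable (fun t => m t * g t ^ 2 - 2 * (u / U) * (m t * g t)) μ :=
        hmg2.sub (hmg.const_mul _)
      rw [integral_add i12 (hmi.const_mul _), integral_sub hmg2 (hmg.const_mul _),
        integral_const_mul, integral_const_mul]
    rw [e] at h0
    have e2 : v - 2 * (u / U) * u + (u / U) ^ 2 * U = v - u ^ 2 / U := by
      field_simp
      ring
    rw [e2] at h0
    have h1 : u ^ 2 / U ≤ v := by linarith
    rw [div_le_iff₀ hUpos] at h1
    linarith

/-- The quadratic-form step: `u² ≤ U v` with `U, r, v ≥ 0` gives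
`(u + r x)² ≤ (U + r)(v + r x²)`. -/
theorem sq_add_mul_le {U r u v x : ℝ} (hU : 0 ≤ U) (hr : 0 ≤ r) (hv : 0 ≤ v)
    (huv : u ^ 2 ≤ U * v) : (u + r * x) ^ 2 ≤ (U + r) * (v + r * x ^ 2) := by
  -- `2 x u ≤ U x² + v`
  have hkey : 2 * x * u ≤ U * x ^ 2 + v := by
    rcases eq_or_lt_of_le hU with hUz | hUpos
    · have hu : u = 0 := by
        rw [← hUz, zero_mul] at huv
        exact pow_eq_zero_iff (n := 2) (by norm_num) |>.1 (le_antisymm huv (sq_nonneg u))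
      rw [hu, ← hUz]
      simpa using hv
    · have h1 : 2 * x * u ≤ U * x ^ 2 + u ^ 2 / U := by
        have h' : U * (2 * x * u) ≤ U ^ 2 * x ^ 2 + u ^ 2 := by
          nlinarith [sq_nonneg (U * x - u)]
        have e : U * (U * x ^ 2 + u ^ 2 / U) = U ^ 2 * x ^ 2 + u ^ 2 := by
          field_simp
        exact le_of_mul_le_mul_left (by rw [e]; exact h') hUpos
      have h2 : u ^ 2 / U ≤ v := (div_le_iff₀ hUpos).2 (by linarith)
      linarith
  have h3 : r * (2 * x * u) ≤ r * (U * x ^ 2 + v) := mul_le_mul_of_nonneg_left hkey hr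
  nlinarith

end CauchySchwarz

end Summit.Ventures.LatticeQCDFlow.Exactness
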